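import Literature.NumberTheory.Sieve.BombieriAsymptoticSieve
import HarnessLib

/-!
# Friedlander–Iwaniec's rank-uniform form of Bombieri's asymptotic sieve: hypothesis (A₆) and
# the Corollary to Theorem 2 (scalar ranks)

Topic `Literature/NumberTheory/Sieve`, family `parity`. Source: J. Friedlander, H. Iwaniec, *On
Bombieri's asymptotic sieve*, Ann. Scuola Norm. Sup. Pisa Cl. Sci. (4) **5** (1978) 719–756
[FriedlanderIwaniecPisa1978], pp. 719–723, READ from the Numdam page images (the text layer drops
every displayed formula; the pages were rendered from the PDF's CCITT-G4 streams and transcribed —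
transcript attached as evidence on the Parity item it grounds).

## What is printed

* pp. 719–720, Assumptions (A₁)–(A₅) (with parameters `θ₀ ∈ (0,1]`, a number field `K`, an integer
  `N`, a model density `f̄`) — for `θ₀ = 1 = N`, `K = ℚ`, `f̄ = f` these are implied clause by clause by
  Bombieri's own (A₁)–(A₅), vendored in the tree as `SieveSequence.IsBombieriSequence` (see the
  module docstring of `BombieriAsymptoticSieve.lean`, "Bombieri's own list (A₁)–(A₅) vendored here is
  clause-by-clause at least as strong"), with ONE proviso made explicit below: FI's `f` is a real
  function with `f(d) > 1` for `d > 1`, i.e. the density `g = 1/f` is POSITIVE, whereas Bombieri's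
  (A₁) (and the tree's) only asks `1/f(d) < 1`.
* p. 720, **(A₆)**: "There exists an integer `g ≥ 2` such that, for `x ≤ X`,
  `∑_{m ≤ x^{1/g}} |R(x, m^g)| ≪ A(x)(log x)^{−2}`, where the implied constant may depend on `g`."
* p. 721: `Λ_k = μ ∗ L^k` (tree: `generalizedVonMangoldt k`), `Λ_(k) = Λ_{k₁} ∗ ⋯ ∗ Λ_{k_r}`,
  `|k| = k₁ + ⋯ + k_r`; "`β(x)` a function satisfying `∫₁^x A(t)/t dt ≤ β(x) A(x) log x`".
* p. 722, Theorem 1 (Bombieri) — tree: `Bombieri1976_asymptotic_sieve` (scalar `(k)`), PROVED there;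
  Theorem 2 (explicit rank-uniform error under (A₁)–(A₆): for `0 < θ < θ₀`, `Δ = (6r)^{16/θ}`,
  `|k| ≥ 2`, `a = max k_ν`, a constant `c = c(θ, θ₀, g, f̄, K, C)` not depending on `(k), r, N`, such that
  `C(|k|,a)(1−θ)^a ≤ 1`, `|k| > cΔ`, `log X > |k|^{c|k|}` imply
  `∑_{n ≤ X} a_n Λ_(k)(n) = γ_(k) H A(X)(log X)^{|k|−1}(1 + φE)`, `|φ| ≤ 1`,
  `E < ((C(|k|,a)(1−θ)^a)^{1/Δ} + (2/(1−θ))^a β(X))(c|k|)^Δ`); Remark I 1): "It is probably sufficient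
  to take `log X > exp(c|k|)` but this would have required a strengthening of A₆".
* p. 723, **Corollary.** "Let `(a_n)` satisfy (A₁–A₆) and assume `β(X) = o(1)`. Let `0 < θ < θ₀`.
  There exists a constant `c`, depending at most on `θ, θ₀, C, K, g` and `f̄` such that if `(k)` ranges
  through a sequence of vectors and `|k| → ∞` subject to (i) `|k| < c log log X/log log log X`,
  (ii) `C(|k|,a) < (1−θ)^{−a}`, (iii) `r < a^{θ/33}`, (iv) `a < c log(1/β(X))`, then we have
  `∑_{n ≤ X} a_n Λ_(k)(n) ∼ γ_(k) H A(X)(log X)^{|k|−1}`." Here `γ_(k) = (k)!/(|k|−1)!`,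
  `H = ∏_p (1 − 1/f(p))(1 − 1/p)⁻¹` (p. 722).

## What is vendored, and how faithfully

* `SieveSequence.BombieriA6` — (A₆) for a FIXED sequence (FI allow `a_n` to depend on `X` with
  uniform constants; a sequence not depending on `X` is the special case), "for `x ≤ X`" becoming
  "for all sufficiently large `x`" exactly as for the tree's (A₂), (A₃).
* `FriedlanderIwaniec1978_corollary_scalar` — the Corollary for SCALAR ranks `(k) = (k)` (`r = 1`,
  `a = |k| = k`, `γ_(k) = k`, so that (ii) `1 < (1−θ)^{−k}` and (iii) `1 < k^{θ/33}` hold automatically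
  for `k ≥ 2`, and `θ` only affects the constant `c`, which is therefore merely asserted to exist),
  in the case `θ₀ = 1 = N`, `K = ℚ`, `f̄ = f` carried by `IsBombieriSequence` plus the positivity
  proviso `0 < g(d)` (`d ≥ 1`) and `BombieriA6`. "`(k)` ranges through a sequence and `|k| → ∞` as
  `X → ∞`" is a rank function `k : ℝ → ℕ` with `k(X) → ∞`; (i) and (iv) are demanded eventually in `X`,
  (iv) for a user-supplied admissible `β` (any `β` with `∫₁^X A(t)dt/t ≤ β(X)A(X) log X` and
  `β → 0`; a larger `β` only shrinks the range, so this is verbatim). The conclusion `∼` is Mathlib's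
  `IsEquivalent` along `atTop` of the two functions of `X`.
  This is a special case of the print (fixed sequence, scalar ranks, `θ₀ = 1`), never stronger.

Grounds (as NEAREST PRINT, not as an equality) the Parity item
`Summit.Parity.GeneralizedHardyLittlewood.Theses.RoughSemiprimeRigidity.RankUniformLambdaK`, which
asks for uniformity over ALL `2 ≤ k ≤ 2 log log x` under (A₁)–(A₅) alone — beyond the printed range
(i) by a factor `log log log X` and without (A₆); that item is therefore STRONGER than anything
vendored here. Deliberately NOT here: the vector case `r ≥ 2` of Theorems 1–2 and of the Corollary
(needs `Λ_(k)` for vectors and `γ_(k)`), Theorem 2's explicit error term, general `θ₀ < 1`, `K ≠ ℚ`,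
`N > 1`, and any proof.
-/

noncomputable section

open Filter Asymptotics Finset
open scoped _root_.Topology

namespace Literature.NumberTheory.Sieve

namespace SieveSequence

/-- Friedlander–Iwaniec's hypothesis **(A₆)** ([FriedlanderIwaniecPisa1978] p. 720), for a fixed
sifted sequence in Bombieri's normalisation (`R(x; d) = A.remainder d x`): there is an integer `g ≥ 2`
such that `∑_{m ≤ x^{1/g}} |R(x, m^g)| ≪_g A(x)(log x)^{−2}` for all sufficiently large `x`.
[cite: FriedlanderIwaniecPisa1978, p. 720 (A₆)] -/
def BombieriA6 (A : SieveSequence) : Prop :=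
  ∃ g : ℕ, 2 ≤ g ∧ ∃ C : ℝ, ∀ᶠ x : ℝ in atTop,
    ∑ m ∈ Icc 1 ⌊x ^ (1 / (g : ℝ))⌋₊, |A.remainder (m ^ g) x| ≤ C * A.size x / Real.log x ^ 2

end SieveSequence

/-- **Friedlander–Iwaniec's rank-uniform asymptotic sieve, scalar ranks** — the Corollary to
Theorem 2 of [FriedlanderIwaniecPisa1978] (p. 723) in the case `(k) = (k)` scalar, `θ₀ = 1 = N`,
`K = ℚ`: let `(a_n)` be a sifted sequence with Bombieri's (A₁)–(A₅) (`A.IsBombieriSequence`, so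
`A.size = A(x) = ∑_{n ≤ x} a_n` and (A₄) gives `β(X) = o(1)`), with POSITIVE density `0 < g(d) = 1/f(d)`
(FI's (A₁): `f(d) > 1` real), satisfying (A₆) (`A.BombieriA6`), and let `H = ∏_p (1 − 1/f(p))(1 − 1/p)⁻¹`
(`A.HasDensityConstant H`). Then there is a constant `c > 0` such that for every admissible
`β` (`∫₁^X A(t)/t dt ≤ β(X) A(X) log X`, `β(X) → 0`) and every rank function `k = k(X) → ∞` with,
for all large `X`, `2 ≤ k(X)`, (i) `k(X) < c · log log X / log log log X` and
(iv) `k(X) < c · log(1/β(X))` (conditions (ii), (iii) of the print are automatic for scalar ranks),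
`∑_{n ≤ X} a_n Λ_{k(X)}(n) ∼ k(X) · H · A(X) · (log X)^{k(X) − 1}` as `X → ∞`
(`γ_(k) = k!/(k−1)! = k`). Special case of the printed Corollary (fixed sequence, scalar ranks);
see the module docstring. Nearest print to, and WEAKER than, the Parity route item
`…RoughSemiprimeRigidity.RankUniformLambdaK` (which wants all `k ≤ 2 log log x` without (A₆)).
[cite: FriedlanderIwaniecPisa1978, p. 723 Corollary (scalar (k), θ₀ = 1 = N, K = ℚ); p. 722 Theorem 2] -/
def FriedlanderIwaniec1978_corollary_scalar : Prop :=
  ∀ (A : SieveSequence) (H : ℝ), A.IsBombieriSequence → (∀ d : ℕ, 1 ≤ d → 0 < A.density d) →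
    A.BombieriA6 → A.HasDensityConstant H →
      ∃ c : ℝ, 0 < c ∧
        ∀ β : ℝ → ℝ,
          (∀ᶠ X : ℝ in atTop, ∫ t in (1 : ℝ)..X, A.size t / t ≤ β X * A.size X * Real.log X) →
          (∀ᶠ X : ℝ in atTop, 0 < β X) → Tendsto β atTop (𝓝 0) →
        ∀ k : ℝ → ℕ, Tendsto k atTop atTop →
          (∀ᶠ X : ℝ in atTop, 2 ≤ k X ∧
              (k X : ℝ) < c * Real.log (Real.log X) / Real.log (Real.log (Real.log X)) ∧
              (k X : ℝ) < c * Real.log (1 / β X)) →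
          (fun X : ℝ => ∑ n ∈ Ioc 0 ⌊X⌋₊, generalizedVonMangoldt (k X) n * A.a n) ~[atTop]
            fun X : ℝ => (k X : ℝ) * H * A.size X * Real.log X ^ (k X - 1)

end Literature.NumberTheory.Sieve

end
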